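import Mathlib

/-!
# Crux `PrimeTwoFamilies` (stmt-MatrixMultiplication-14308), line `Sketch` — stub `stub_honestOfSelfConverse`
# (siege k17, Mathlib API route)

Self-converse gadgets contain honest SDPP designs in the SAME `ℤ/m`, by one call to Mathlib's weighted
pigeonhole principle (`Finset.exists_le_card_fiber_of_nsmul_le_card_of_maps_to`) on the incidence set
"(letter, side, point)": some coloured point `(z, side)` lies in `≥ m^{1/2-ε}` letters on that side; such
letters are pairwise non-separated, so their `π`-images are pairwise separated and form an honest family.

Helper file landed `--supports stmt-MatrixMultiplication-14308`; the final theorem is the registered stub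
signature verbatim (gadget / SDPP clauses inlined, no definitions).  Independent of the tree's other proof
of the same stub (namespace `…CapacityLift`): no popular-point maximisation, no case split on the heavier
side, no threshold on `m` — the AM–GM factor `2` is absorbed by colouring points with the side (`2m` holes).
-/

-- single-conjunct summit: the mandated namespace repeats `MatrixMultiplication`.
set_option linter.dupNamespace false

namespace Summit.MatrixMultiplication.MatrixMultiplication.Theorems.PrimeTwoFamilies.HonestOfSelfConverseK17

open Finset

/-- **Pairwise non-separated letters give an honest family after `π`.**  In a gadget of direct pairs
`(P c, Q c)` with the self-converse property for `π` (every ordered pair of distinct letters is strongly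
separated directly or after `π`), if the injectively indexed letters `e i` are pairwise NOT strongly
separated, then `(P ∘ π ∘ e, Q ∘ π ∘ e)` satisfies the SDPP clauses (W) and (X) verbatim: (W) is the
directness of the letter `π (e i)`, and a violation of (X) at `(i, j, k)`, `i ≠ k`, is a coincidence of a cross
difference `Q (π (e k)) − P (π (e i))` with a diagonal difference of the letter `π (e j)`. -/
theorem sdpp_image_of_pairwise_not_separated {K : Type*} [AddCommGroup K] {r n : ℕ}
    (P Q : Fin r → Finset K)
    (hD : ∀ c : Fin r, ∀ x ∈ P c, ∀ x' ∈ P c, ∀ y ∈ Q c, ∀ y' ∈ Q c,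
      (x - x') + (y - y') = 0 → x = x' ∧ y = y')
    (π : Fin r → Fin r)
    (hπ : ∀ σ τ : Fin r, σ ≠ τ →
      (∀ x ∈ P σ, ∀ y ∈ Q τ, ∀ c : Fin r, ∀ x' ∈ P c, ∀ y' ∈ Q c, y - x ≠ y' - x') ∨
      (∀ x ∈ P (π σ), ∀ y ∈ Q (π τ), ∀ c : Fin r, ∀ x' ∈ P c, ∀ y' ∈ Q c, y - x ≠ y' - x'))
    (e : Fin n → Fin r) (he : Function.Injective e)
    (hns : ∀ i j : Fin n, i ≠ j →
      ¬ ∀ x ∈ P (e i), ∀ y ∈ Q (e j), ∀ c : Fin r, ∀ x' ∈ P c, ∀ y' ∈ Q c, y - x ≠ y' - x') :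
    (∀ i : Fin n, ∀ a ∈ P (π (e i)), ∀ a' ∈ P (π (e i)), ∀ b ∈ Q (π (e i)), ∀ b' ∈ Q (π (e i)),
        (a - a') + (b - b') = 0 → a = a' ∧ b = b') ∧
    (∀ i j k : Fin n, ∀ a ∈ P (π (e i)), ∀ a' ∈ P (π (e j)), ∀ b ∈ Q (π (e j)), ∀ b' ∈ Q (π (e k)),
        (a - a') + (b - b') = 0 → i = k) := by
  refine ⟨fun i => hD (π (e i)), fun i j k a ha a' ha' b hb b' hb' h0 => ?_⟩
  by_contra hik
  have hsep := (hπ (e i) (e k) (he.ne hik)).resolve_left (hns i k hik)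
  refine hsep a ha b' hb' (π (e j)) a' ha' b hb ?_
  have h1 : (b' - a) - (b - a') = -((a - a') + (b - b')) := by abel
  rw [h0, neg_zero, sub_eq_zero] at h1
  exact h1

/-- **AM–GM for the two sides of a letter**: `t² ≤ |P| · |Q|` forces `2t ≤ |P| + |Q|` (for `|P|, |Q| ≥ 0`;
no sign condition on `t` is needed). -/
theorem two_mul_le_add_of_sq_le_mul {a b t : ℝ} (ha : 0 ≤ a) (hb : 0 ≤ b)
    (h : t * t ≤ a * b) : 2 * t ≤ a + b := by
  nlinarith [sq_nonneg (a - b), sq_nonneg (a + b - 2 * t), mul_nonneg ha hb]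

/-- **Self-converse gadgets contain honest designs** (registered stub `stub_honestOfSelfConverse` of line
`Sketch`, crux stmt-MatrixMultiplication-14308; Mathlib pigeonhole route).  If for every `ε > 0` there
are arbitrarily large `m`, a gadget of `r ≥ m^{1-ε}` direct pairs `(P c, Q c)` in `ℤ/m` of co-volume
`≥ m^{1-ε}`, and a map `π` under which every ordered pair of distinct letters is strongly separated directly
or after `π`, then for every `ε > 0` there are arbitrarily large `m` and an SDPP family ((W) ∧ (X)
verbatim) in the same `ℤ/m` with `n ≥ m^{1/2-ε}` pairs of co-volume `≥ m^{1-ε}`.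
Proof: use the hypothesis at `ε/2` and `m ≥ max m₀ 1`; by AM–GM every letter has
`|P c| + |Q c| ≥ 2 m^{(1-ε/2)/2}`, so the incidence set `{(c, side, z) : z ∈ side c}` has
`≥ 2 r m^{(1-ε/2)/2} ≥ 2m · m^{1/2-3ε/4}` elements over the `2m` coloured points `(z, side)`; the
pigeonhole principle gives a coloured point in `≥ m^{1/2-ε}` letters, which are pairwise non-separated
(the common point produces a cross difference equal to a diagonal one), and
`sdpp_image_of_pairwise_not_separated` turns their `π`-images into the honest family. -/
theorem stub_honestOfSelfConverse
    (h : ∀ ε : ℝ, 0 < ε → ∀ m₀ : ℕ, ∃ m ≥ m₀, ∃ r : ℕ, ∃ P Q : Fin r → Finset (ZMod m),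
      ∃ π : Fin r → Fin r,
        (∀ c : Fin r, ∀ x ∈ P c, ∀ x' ∈ P c, ∀ y ∈ Q c, ∀ y' ∈ Q c,
            (x - x') + (y - y') = 0 → x = x' ∧ y = y') ∧
        (∀ σ τ : Fin r, σ ≠ τ →
            (∀ x ∈ P σ, ∀ y ∈ Q τ, ∀ c : Fin r, ∀ x' ∈ P c, ∀ y' ∈ Q c, y - x ≠ y' - x') ∨
            (∀ x ∈ P (π σ), ∀ y ∈ Q (π τ), ∀ c : Fin r, ∀ x' ∈ P c, ∀ y' ∈ Q c, y - x ≠ y' - x')) ∧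
        (m : ℝ) ^ (1 - ε) ≤ (r : ℝ) ∧
        ∀ c : Fin r, (m : ℝ) ^ (1 - ε) ≤ (((P c).card * (Q c).card : ℕ) : ℝ)) :
    ∀ ε : ℝ, 0 < ε → ∀ m₀ : ℕ, ∃ m ≥ m₀, ∃ n : ℕ, ∃ A B : Fin n → Finset (ZMod m),
      (∀ i : Fin n, ∀ a ∈ A i, ∀ a' ∈ A i, ∀ b ∈ B i, ∀ b' ∈ B i,
          (a - a') + (b - b') = 0 → a = a' ∧ b = b') ∧
      (∀ i j k : Fin n, ∀ a ∈ A i, ∀ a' ∈ A j, ∀ b ∈ B j, ∀ b' ∈ B k,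
          (a - a') + (b - b') = 0 → i = k) ∧
      (m : ℝ) ^ (1 / 2 - ε) ≤ (n : ℝ) ∧
      ∀ i : Fin n, (m : ℝ) ^ (1 - ε) ≤ (((A i).card * (B i).card : ℕ) : ℝ) := by
  intro ε hε m₀
  obtain ⟨m, hm, r, P, Q, π, hD, hπ, hr, hcov⟩ := h (ε / 2) (half_pos hε) (max m₀ 1)
  have hm₀ : m₀ ≤ m := (le_max_left _ _).trans hm
  have hm1 : 1 ≤ m := (le_max_right _ _).trans hm
  haveI : NeZero m := ⟨by omega⟩
  have hm1' : (1 : ℝ) ≤ m := by exact_mod_cast hm1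
  have hm0' : (0 : ℝ) < m := by linarith
  -- every letter is nonempty on both sides
  have hpos : ∀ c, 0 < (P c).card * (Q c).card := fun c => by
    have h2 := (Real.rpow_pos_of_pos hm0' (1 - ε / 2)).trans_le (hcov c)
    exact_mod_cast h2
  have hPne : ∀ c, (P c).Nonempty := fun c =>
    card_pos.1 (Nat.pos_of_mul_pos_right (hpos c))
  have hQne : ∀ c, (Q c).Nonempty := fun c =>
    card_pos.1 (Nat.pos_of_mul_pos_left (hpos c))
  -- AM–GM: every letter has `|P c| + |Q c| ≥ 2t`, `t := m^{(1-ε/2)/2}`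
  set t : ℝ := (m : ℝ) ^ ((1 - ε / 2) / 2) with ht
  have ht0 : 0 ≤ t := (Real.rpow_pos_of_pos hm0' _).le
  have htt : t * t = (m : ℝ) ^ (1 - ε / 2) := by
    rw [ht, ← Real.rpow_add hm0']
    ring_nf
  have hside : ∀ c, 2 * t ≤ ((P c).card : ℝ) + ((Q c).card : ℝ) := fun c =>
    two_mul_le_add_of_sq_le_mul (Nat.cast_nonneg _) (Nat.cast_nonneg _)
      (by rw [htt]; exact_mod_cast hcov c)
  -- exponent bookkeeping: `2m · m^{1/2-ε} ≤ 2 · m^{1-ε/2} · t ≤ 2 r t`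
  have hkey : (m : ℝ) * (m : ℝ) ^ (1 / 2 - 3 * ε / 4) = (m : ℝ) ^ (1 - ε / 2) * t := by
    rw [ht, ← Real.rpow_add hm0']
    calc (m : ℝ) * (m : ℝ) ^ (1 / 2 - 3 * ε / 4)
        = (m : ℝ) ^ (1 : ℝ) * (m : ℝ) ^ (1 / 2 - 3 * ε / 4) := by rw [Real.rpow_one]
      _ = (m : ℝ) ^ ((1 : ℝ) + (1 / 2 - 3 * ε / 4)) := (Real.rpow_add hm0' _ _).symm
      _ = (m : ℝ) ^ (1 - ε / 2 + (1 - ε / 2) / 2) := by congr 1; ring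
  have hexp : (m : ℝ) ^ (1 / 2 - ε) ≤ (m : ℝ) ^ (1 / 2 - 3 * ε / 4) :=
    Real.rpow_le_rpow_of_exponent_le hm1' (by linarith)
  have htotal : ((m * 2 : ℕ) : ℝ) * (m : ℝ) ^ (1 / 2 - ε) ≤
      ∑ c : Fin r, (((P c).card : ℝ) + ((Q c).card : ℝ)) := by
    calc ((m * 2 : ℕ) : ℝ) * (m : ℝ) ^ (1 / 2 - ε)
        ≤ ((m * 2 : ℕ) : ℝ) * (m : ℝ) ^ (1 / 2 - 3 * ε / 4) :=
          mul_le_mul_of_nonneg_left hexp (Nat.cast_nonneg _)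
      _ = 2 * ((m : ℝ) ^ (1 - ε / 2) * t) := by rw [← hkey]; push_cast; ring
      _ ≤ 2 * ((r : ℝ) * t) := by
          have := mul_le_mul_of_nonneg_right hr ht0
          linarith
      _ = ∑ _c : Fin r, 2 * t := by
          rw [sum_const, card_univ, Fintype.card_fin, nsmul_eq_mul]; ring
      _ ≤ ∑ c : Fin r, (((P c).card : ℝ) + ((Q c).card : ℝ)) := sum_le_sum fun c _ => hside c
  -- the incidence set over the `2m` coloured points, and the pigeonhole principle
  let side : Fin r × Bool → Finset (ZMod m) := fun cb => bif cb.2 then P cb.1 else Q cb.1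
  let s : Finset (Σ _ : Fin r × Bool, ZMod m) := univ.sigma side
  let f : (Σ _ : Fin r × Bool, ZMod m) → ZMod m × Bool := fun x => (x.2, x.1.2)
  have hcard : (s.card : ℝ) = ∑ c : Fin r, (((P c).card : ℝ) + ((Q c).card : ℝ)) := by
    have h1 : s.card = ∑ c : Fin r, ((P c).card + (Q c).card) := by
      simp only [s, card_sigma, Fintype.sum_prod_type, Fintype.sum_bool, side, cond_true, cond_false]
    rw [h1]
    push_cast
    rfl
  have hb : (univ : Finset (ZMod m × Bool)).card • (m : ℝ) ^ (1 / 2 - ε) ≤ (s.card : ℝ) := by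
    rw [card_univ, Fintype.card_prod, ZMod.card, Fintype.card_bool, nsmul_eq_mul, hcard]
    exact htotal
  obtain ⟨⟨z, b⟩, -, hfib⟩ := exists_le_card_fiber_of_nsmul_le_card_of_maps_to
    (s := s) (t := univ) (f := f) (fun _ _ => mem_univ _) univ_nonempty hb
  -- the letters through the coloured point `(z, b)`
  set T : Finset (Fin r) := univ.filter fun c => z ∈ side (c, b) with hT
  have hFT : (s.filter fun x => f x = (z, b)).card ≤ T.card := by
    refine card_le_card_of_injOn (fun x => x.1.1) (fun x hx => ?_) ?_
    · obtain ⟨⟨c, b'⟩, z'⟩ := x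
      simp only [coe_filter, Set.mem_setOf_eq, s, mem_sigma, mem_univ, true_and, f,
        Prod.mk.injEq] at hx
      obtain ⟨hmem, rfl, rfl⟩ := hx
      simp only [hT, coe_filter, mem_univ, true_and, Set.mem_setOf_eq]
      exact hmem
    · rintro ⟨⟨c, b'⟩, z'⟩ hx ⟨⟨c', b''⟩, z''⟩ hx' hcc
      simp only [coe_filter, Set.mem_setOf_eq, s, mem_sigma, mem_univ, true_and, f,
        Prod.mk.injEq] at hx hx'
      obtain ⟨-, rfl, rfl⟩ := hx
      obtain ⟨-, rfl, hbb⟩ := hx'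
      simp only at hcc
      subst hcc
      subst hbb
      rfl
  -- enumerate them
  set n : ℕ := T.card with hn
  let e : Fin n → Fin r := fun i => T.orderEmbOfFin rfl i
  have he : Function.Injective e := (T.orderEmbOfFin rfl).injective
  have heT : ∀ i, z ∈ side (e i, b) := fun i => by
    have hmem : e i ∈ T := T.orderEmbOfFin_mem rfl i
    rw [hT, mem_filter] at hmem
    exact hmem.2
  -- letters through a common coloured point are pairwise non-separated
  have hns : ∀ i j : Fin n, i ≠ j →
      ¬ ∀ x ∈ P (e i), ∀ y ∈ Q (e j), ∀ c : Fin r, ∀ x' ∈ P c, ∀ y' ∈ Q c, y - x ≠ y' - x' := by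
    intro i j _ hs
    cases b with
    | false =>
      -- common point on the `Q`-side
      obtain ⟨x, hx⟩ := hPne (e i)
      exact hs x hx z (heT j) (e i) x hx z (heT i) rfl
    | true =>
      -- common point on the `P`-side
      obtain ⟨y, hy⟩ := hQne (e j)
      exact hs z (heT i) y hy (e j) z (heT j) y hy rfl
  obtain ⟨hW, hX⟩ := sdpp_image_of_pairwise_not_separated P Q hD π hπ e he hns
  refine ⟨m, hm₀, n, fun i => P (π (e i)), fun i => Q (π (e i)), hW, hX, ?_, fun i => ?_⟩
  · calc (m : ℝ) ^ (1 / 2 - ε) ≤ ((s.filter fun x => f x = (z, b)).card : ℝ) := hfib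
      _ ≤ (n : ℝ) := by rw [hn]; exact_mod_cast hFT
  · calc (m : ℝ) ^ (1 - ε) ≤ (m : ℝ) ^ (1 - ε / 2) :=
          Real.rpow_le_rpow_of_exponent_le hm1' (by linarith)
      _ ≤ _ := hcov (π (e i))

end Summit.MatrixMultiplication.MatrixMultiplication.Theorems.PrimeTwoFamilies.HonestOfSelfConverseK17
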